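import Literature.AlgebraicGeometry.Resolution.SyzygyStaircase
import Literature.AlgebraicGeometry.Resolution.PresentationExtLocalization
import Literature.AlgebraicGeometry.Resolution.AnnihilatorLocalization
import Mathlib.RingTheory.Localization.BaseChange
import HarnessLib

/-!
# The `Ext`-annihilator ideals commute with localization (equality)

Topic: `Literature/AlgebraicGeometry/Resolution`. For a free resolution of finite type `F` of `M`
over a Noetherian ring `R`, a localization `R → R_S` and a base change `φ : M → M'` to `R_S`
(`IsBaseChange R_S φ`), the base-changed resolution `F ⊗ R_S` (`F.baseChange R_S φ hφ`,
`SyzygySheaf.lean`) computes the modules `E^{q+1}` of `SyzygyStaircase.lean` for `M'`, and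

* `FreeResolution.isLocalizedModule_EMod_baseChange` — `E^{q+1}(F) → E^{q+1}(F ⊗ R_S)` is a
  localization map (`PresentationExtLocalization.lean` applied to the syzygy presentations);
* `FreeResolution.annihilator_EMod_baseChange_eq` — **`Ann_{R_S} E^{q+1}(F ⊗ R_S) =
  (Ann_R E^{q+1}(F)) R_S`** (equality; the inclusion `⊇` alone is
  `ExtAnnihilatorBaseChange.map_annihilator_EMod_baseChange_le`);
* `FreeResolution.prod_annihilator_EMod_baseChange_eq` — the same for the products over index
  windows of positive integers: **the `Ext`-annihilator ideal localizes, `𝔠(M_S) = 𝔠(M) R_S`**.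

With `ExtAnnihilatorIndependence.lean` (independence of the resolution) this makes
`𝔠 = ∏_{q ∈ window} Ann Ext^q(M, R)` a canonical invariant compatible with localization.
[cite: Matsumura1987, Thm. 7.11; AtiyahMacdonald1969, Prop. 3.14]
-/

noncomputable section

open Module

universe u

namespace Literature.AlgebraicGeometry.Resolution

namespace FreeResolution

variable {R : Type u} [CommRing R] [IsNoetherianRing R] {M : Type u} [AddCommGroup M] [Module R M]
  (F : FreeResolution R M) (S : Submonoid R) (Rₛ : Type u) [CommRing Rₛ] [Algebra R Rₛ]
  [IsLocalization S Rₛ] [Module.Flat R Rₛ]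
  {M' : Type u} [AddCommGroup M'] [Module R M'] [Module Rₛ M'] [IsScalarTower R Rₛ M']
  (φ : M →ₗ[R] M') (hφ : IsBaseChange Rₛ φ)

omit [IsNoetherianRing R] in
/-- `K_{q+1}(F) → K_{q+1}(F ⊗ R_S)` is a localization map at `S`. [folklore] -/
theorem isLocalizedModule_syzygyMap' (q : ℕ) :
    IsLocalizedModule S (F.syzygyMap Rₛ φ hφ q) := by
  haveI : IsLocalizedModule S φ := (isLocalizedModule_iff_isBaseChange S Rₛ φ).2 hφ
  exact F.isLocalizedModule_syzygyMap Rₛ φ S q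

omit [IsNoetherianRing R] [Module.Flat R Rₛ] in
include S in
/-- `R^r → R_S^r` is a localization map at `S`. [folklore] -/
theorem isLocalizedModule_piAlgebraMap (r : ℕ) :
    IsLocalizedModule S (piAlgebraMap R Rₛ r) :=
  (isLocalizedModule_iff_isBaseChange S Rₛ _).2 (isBaseChange_piAlgebraMap R Rₛ r)

/-- **`E^{q+1}(F) → E^{q+1}(F ⊗ R_S)` is a localization map at `S`.**
[cite: Matsumura1987, Thm. 7.11] -/
theorem isLocalizedModule_EMod_baseChange (q : ℕ) :
    ∃ θ : F.EMod (q + 1) →ₗ[R] (F.baseChange Rₛ φ hφ).EMod (q + 1), IsLocalizedModule S θ := by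
  haveI := F.isLocalizedModule_syzygyMap' S Rₛ φ hφ q
  haveI := isLocalizedModule_piAlgebraMap S Rₛ (F.rank q)
  haveI : Module.FinitePresentation R (F.syzygyObj (q + 1)) :=
    Module.finitePresentation_of_finite R _
  haveI : Module.FinitePresentation R (F.coverObj q) := Module.finitePresentation_of_finite R _
  have hcompat : ∀ y : F.syzygyObj (q + 1),
      ((F.baseChange Rₛ φ hφ).syzygyι q).hom (F.syzygyMap Rₛ φ hφ q y) =
        piAlgebraMap R Rₛ (F.rank q) ((F.syzygyι q).hom y) := fun _ => rfl
  exact ⟨_, PresExt.isLocalizedModule_ELocalize S Rₛ (K := F.syzygyObj (q + 1))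
    (P := F.coverObj q) (K' := (F.baseChange Rₛ φ hφ).syzygyObj (q + 1))
    (P' := (F.baseChange Rₛ φ hφ).coverObj q) (F.syzygyMap Rₛ φ hφ q)
    (piAlgebraMap R Rₛ (F.rank q)) (F.syzygyι q).hom ((F.baseChange Rₛ φ hφ).syzygyι q).hom
    hcompat⟩

include S in
/-- **The `Ext`-annihilators localize (equality)**:
`Ann_{R_S} E^{q+1}(F ⊗ R_S) = (Ann_R E^{q+1}(F)) · R_S`.
[cite: Matsumura1987, Thm. 7.11; AtiyahMacdonald1969, Prop. 3.14] -/
theorem annihilator_EMod_baseChange_eq (q : ℕ) :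
    Module.annihilator Rₛ ((F.baseChange Rₛ φ hφ).EMod (q + 1)) =
      (Module.annihilator R (F.EMod (q + 1))).map (algebraMap R Rₛ) := by
  obtain ⟨θ, hθ⟩ := F.isLocalizedModule_EMod_baseChange S Rₛ φ hφ q
  exact annihilator_eq_map_of_isLocalizedModule S Rₛ θ

include S in
/-- **The `Ext`-annihilator ideal localizes**: for an index set `T` of positive integers,
`∏_{q ∈ T} Ann E^q(F ⊗ R_S) = (∏_{q ∈ T} Ann E^q(F)) · R_S`.
[cite: Matsumura1987, Thm. 7.11; AtiyahMacdonald1969, Prop. 3.14] -/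
theorem prod_annihilator_EMod_baseChange_eq (T : Finset ℕ) (hT : ∀ q ∈ T, 1 ≤ q) :
    (∏ q ∈ T, Module.annihilator Rₛ ((F.baseChange Rₛ φ hφ).EMod q)) =
      (∏ q ∈ T, Module.annihilator R (F.EMod q)).map (algebraMap R Rₛ) := by
  classical
  induction T using Finset.induction_on with
  | empty => simp [Ideal.map_top]
  | insert a T haT ih =>
    rw [Finset.prod_insert haT, Finset.prod_insert haT, Ideal.map_mul,
      ih fun q hq => hT q (Finset.mem_insert_of_mem hq)]
    obtain ⟨a', rfl⟩ : ∃ a', a = a' + 1 :=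
      ⟨a - 1, by have := hT a (Finset.mem_insert_self a T); omega⟩
    rw [F.annihilator_EMod_baseChange_eq S Rₛ φ hφ a']

end FreeResolution

end Literature.AlgebraicGeometry.Resolution

end
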